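import Summits.Ventures.PercRepro.Night2LocalSimpleCount

/-!
# PercRepro — counting lemmas for simple planes, III: coloops of a shadow set; a side of co-size 1 (night-2, gen 9)

At a type-`(2, 1)` flat the shadow sets are `S = {y} ∪ T` with `y` a coloop and `T` a spanning subset of the
plane; in a simple plane a `T` with `≥ 4` elements has at most one element `z` with `T ∖ {z}` collinear
(`card_filter_rkN_erase_eq_two_le_one`), so `S` has at most two coloops (`y` and that `z`).  This bounds the
cover preimages of the columns of level `≥ 5` in the scheme S6 (NIGHT-2-local.md §19 ADDENDUM 8).
-/

namespace PercRepro.Shadow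

open Finset PerFlat ThmH

variable {α : Type*} [DecidableEq α] {M : Matroid α} [M.Finite]

/-- `rkN` version of `eRk_insert_of_notMem_clF_erase`. -/
theorem rkN_insert_of_notMem_clF_erase {G : Finset α} (hG : G ⊆ gr M) {y : α} (hy : y ∈ G)
    (hycl : y ∉ clF M (G.erase y)) {X : Finset α} (hX : X ⊆ G.erase y) :
    rkN M (insert y X) = rkN M X + 1 := by
  have h := eRk_insert_of_notMem_clF_erase hG hy hycl hX
  rw [eRk_eq_rkN, eRk_eq_rkN] at h
  exact_mod_cast h

/-- A coloop `z ≠ y` of `S` (with `y` a coloop of `S`) makes `(S ∖ {y}) ∖ {z}` of rank `ρ(S) − 2`. -/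
theorem rkN_erase_erase_of_mem_coloops {S : Finset α} (hS : S ⊆ gr M) {y : α} (hy : y ∈ S)
    (hycl : y ∉ clF M (S.erase y)) {z : α} (hz : z ∈ coloops M S) (hzy : z ≠ y) :
    rkN M ((S.erase y).erase z) + 2 = rkN M S := by
  rw [mem_coloops] at hz
  -- `ρ(S) = ρ(S ∖ z) + 1`
  have h1 : rkN M S = rkN M (S.erase z) + 1 := by
    have := rkN_insert_of_notMem_clF_erase hS hz.1 hz.2 (X := S.erase z) (Finset.Subset.refl _)
    rwa [Finset.insert_erase hz.1] at this
  -- `ρ(S ∖ z) = ρ((S ∖ z) ∖ y) + 1`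
  have hyz : y ∈ S.erase z := Finset.mem_erase.2 ⟨hzy.symm, hy⟩
  have hycl' : y ∉ clF M ((S.erase z).erase y) := fun h =>
    hycl (clF_mono (fun e he => by
      rw [Finset.mem_erase] at he ⊢
      exact ⟨he.1, (Finset.mem_erase.1 he.2).2⟩) h)
  have h2 : rkN M (S.erase z) = rkN M ((S.erase z).erase y) + 1 := by
    have := rkN_insert_of_notMem_clF_erase ((Finset.erase_subset _ _).trans hS) hyz hycl'
      (X := (S.erase z).erase y) (Finset.Subset.refl _)
    rwa [Finset.insert_erase hyz] at this
  rw [Finset.erase_right_comm]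
  omega

/-- **At most two coloops**: if `y ∈ S` is not in the closure of `S ∖ {y}`, the elements of `S ∖ {y}` are
pairwise of rank `2`, `ρ(S) = 4` and `|S ∖ {y}| ≥ 4`, then `S` has at most two coloops. -/
theorem card_coloops_le_two_of_simple {S : Finset α} (hS : S ⊆ gr M) {y : α} (hy : y ∈ S)
    (hycl : y ∉ clF M (S.erase y))
    (hsimple : ∀ e ∈ S.erase y, ∀ f ∈ S.erase y, e ≠ f → rkN M {e, f} = 2)
    (hr : rkN M S = 4) (h4 : 4 ≤ (S.erase y).card) : (coloops M S).card ≤ 2 := by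
  have hT : rkN M (S.erase y) = 3 := by
    have := rkN_insert_of_notMem_clF_erase hS hy hycl (X := S.erase y) (Finset.Subset.refl _)
    rw [Finset.insert_erase hy, hr] at this
    omega
  have hsub : coloops M S ⊆ insert y ((S.erase y).filter (fun e => rkN M ((S.erase y).erase e) = 2)) := by
    intro z hz
    rw [Finset.mem_insert]
    by_cases hzy : z = y
    · exact Or.inl hzy
    · right
      rw [Finset.mem_filter]
      refine ⟨Finset.mem_erase.2 ⟨hzy, (mem_coloops.1 hz).1⟩, ?_⟩
      have := rkN_erase_erase_of_mem_coloops hS hy hycl hz hzy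
      omega
  calc (coloops M S).card ≤ (insert y ((S.erase y).filter (fun e => rkN M ((S.erase y).erase e) = 2))).card :=
        Finset.card_le_card hsub
    _ ≤ ((S.erase y).filter (fun e => rkN M ((S.erase y).erase e) = 2)).card + 1 := Finset.card_insert_le _ _
    _ ≤ 1 + 1 := by
        have := card_filter_rkN_erase_eq_two_le_one (M := M) hsimple hT h4
        omega

/-- **A side of co-size `1` kills the other sides**: if the plane `P` is `cl {a, b}` plus the point `c`
(`m = 1` for the side `{a, b}`), then `P ∖ {a, c}` has rank `≤ 2` — so `{a, c}` (and likewise `{b, c}`) is not a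
member of the plane statement. -/
theorem rkN_sdiff_le_two_of_subset_insert_clF {P : Finset α} {a b c : α}
    (hP : P ⊆ insert c (clF M {a, b})) : rkN M (P \ {a, c}) ≤ 2 := by
  have hsub : P \ {a, c} ⊆ clF M {a, b} := by
    intro e he
    rw [Finset.mem_sdiff, Finset.mem_insert, Finset.mem_singleton] at he
    have := hP he.1
    rw [Finset.mem_insert] at this
    rcases this with rfl | h
    · exact absurd (Or.inr rfl) he.2
    · exact h
  have h := rkN_mono (M := M) hsub
  rw [rkN_clF] at h
  exact h.trans ((rkN_le_card _).trans Finset.card_le_two)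

end PercRepro.Shadow
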